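import Literature.Analysis.FluidPDE.TaoCascadeDuhamel
import Literature.Analysis.FluidPDE.TaoCascadeMotion
import HarnessLib

/-!
# `PerpetualPump.PumpTransfer` (stmt-NavierStokesRegularity-1837), line `Sketch`: band sums on the Fourier side

Helper file (theorems only) for the registered stub `stub_bandField_exists` of the lead's skeleton
`Cruxes/PumpTransfer/Lines/Sketch.lean` (lead prover prover-line-stmt-NavierStokesRegularity-1837-0):
the a.e. algebra of **band sums** `∑_p c_p(ξ) ψ̂_p(ξ)`, `p = (i,n)`, `ψ̂_p = 𝓕 ψ_{i,n}` the wavelets of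
the data `𝒟`.

Vocabulary: Tao's cascade operator (4.1) with wavelet data `𝒟 : CascadeWaveletData ε₀ m`
(`Literature/Analysis/FluidPDE/TaoCascadeOperator.lean`), the heat fibres `duhamelScalar δ Qr L t`,
weights `modeWeight 𝒟 i n = |ψ̂_{i,n}|²` and `modeDelta` (`TaoCascadeDuhamel.lean`), `heatRate ξ = 4π²|ξ|²`
(`TaoBandHeatGroup.lean`), the circuit nonlinearity `TaoCascade.quadTerm` (`TaoCascadeODE.lean`).

## Contents

* `ae_wavelet_cases`: for a.e. `ξ` at most one `ψ̂_p(ξ)` is nonzero (the frequency regions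
  `(1+ε₀)ⁿ(Bᵢ ∪ -Bᵢ)` are pairwise disjoint, `CascadeWaveletData.not_mem_freqRegion_of_ne`), so
  every band sum collapses a.e. to one term;
* `ae_weight_enorm_bandSum_le`, `lintegral_weight_enorm_bandSum_le`: the weighted bounds
  `(1+|ξ|²)^{10} |∑_p c_p ψ̂_p|² ≤ ∑_p 5^{10}(1+(1+ε₀)^{10n})² c_p² |ψ̂_p|²` a.e. and
  `∫ (1+|ξ|²)^{10} |∑_p c_p ψ̂_p|² ≤ ∑_p 5^{10}(1+(1+ε₀)^{10n})² B_p²` for `|c_p| ≤ B_p`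
  (on the region of `p`, `|ξ| ≤ 2(1+ε₀)ⁿ`; `∫ |ψ̂_p|² = 1`);
* `aestronglyMeasurable_bandSum` (a.e. limit of the finite partial sums),
  `ae_conj3_bandSum_neg` (conjugation symmetry for even real coefficients: the wavelets are real),
  `ae_cdot_bandSum_eq_zero` (divergence free: `ξ · ψ̂_p(ξ) = 0`), `ae_bandSum_sub`;
* from a Fourier-side representative `g ∈ L²` to the field `𝓕⁻¹ g`: `fourierFn_fourierInv_toLp`,
  `fourierFn_sub`, `isReal_of_fourierFn_conj_symm`, `memLp_two_of_sobolevWeightIntegral_lt_top`.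

## References

* T. Tao, J. Amer. Math. Soc. 29 (2016), 601–674 = arXiv:1402.0290v3, §4 Lemma 4.1 (4.14). [`Tao2016AveragedNS`]
-/

noncomputable section

-- the nested summit namespace is the tree's layout (D-0017)
set_option linter.dupNamespace false

namespace Summit.NavierStokesRegularity.NavierStokesRegularity.Theorems.PerpetualPumpPumpTransfer

open MeasureTheory Set Filter Topology FourierTransform
open scoped ENNReal SchwartzMap ComplexConjugate
open Literature.Analysis Literature.Analysis.FluidPDE Literature.Analysis.FluidPDE.Tao2016

variable {ε₀ : ℝ} {m : ℕ}

/-! ### Band sums on the Fourier side: a.e. at most one wavelet is present -/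

/-- **Band structure, a.e. form**: for a.e. frequency `ξ`, either every `ψ̂_p(ξ)` vanishes, or `ξ`
lies in the region of one mode `p₀` and every other `ψ̂_p(ξ)` vanishes (the wavelets live on
pairwise disjoint frequency regions). [cite: Tao2016AveragedNS, §4 Lemma 4.1] -/
theorem ae_wavelet_cases (hε₀ : 0 < ε₀) (𝒟 : CascadeWaveletData ε₀ m) :
    ∀ᵐ ξ ∂(volume : Measure (EuclideanSpace ℝ (Fin 3))),
      (∀ p : Fin m × ℤ, fourierFn (cascadeWavelet ε₀ (𝒟.ψ p.1) p.2) ξ = 0) ∨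
      ∃ p₀ : Fin m × ℤ, ξ ∈ freqRegion 𝒟 p₀.1 p₀.2 ∧
        ∀ p : Fin m × ℤ, p ≠ p₀ → fourierFn (cascadeWavelet ε₀ (𝒟.ψ p.1) p.2) ξ = 0 := by
  have hε' : 0 < 1 + ε₀ := by linarith
  have hzero : ∀ᵐ ξ ∂(volume : Measure (EuclideanSpace ℝ (Fin 3))), ∀ p : Fin m × ℤ,
      ξ ∉ freqRegion 𝒟 p.1 p.2 → fourierFn (cascadeWavelet ε₀ (𝒟.ψ p.1) p.2) ξ = 0 :=
    ae_all_iff.2 fun p => 𝒟.fourierFn_cascadeWavelet_eq_zero hε' p.1 p.2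
  filter_upwards [hzero] with ξ hξ
  by_cases hex : ∃ p₀ : Fin m × ℤ, ξ ∈ freqRegion 𝒟 p₀.1 p₀.2
  · obtain ⟨p₀, hp₀⟩ := hex
    exact Or.inr ⟨p₀, hp₀, fun p hp => hξ p (𝒟.not_mem_freqRegion_of_ne hε₀ (Ne.symm hp) hp₀)⟩
  · exact Or.inl fun p => hξ p fun h => hex ⟨p, h⟩

/-- `∫ |ψ̂_{i,n}|² = ‖ψ_{i,n}‖² = 1` (Plancherel), in the `ℝ≥0∞` form with a natural-number square. [cite: Tao2016AveragedNS, §4 p. 21] -/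
theorem lintegral_enorm_sq_fourierFn_cascadeWavelet (hε : 0 < 1 + ε₀) (𝒟 : CascadeWaveletData ε₀ m)
    (i : Fin m) (n : ℤ) :
    ∫⁻ ξ, ‖fourierFn (cascadeWavelet ε₀ (𝒟.ψ i) n) ξ‖ₑ ^ 2 ∂(volume : Measure (EuclideanSpace ℝ (Fin 3))) = 1 := by
  have h := 𝒟.lintegral_fourierFn_cascadeWavelet hε i n
  have h2 : ∫⁻ ξ, ‖fourierFn (cascadeWavelet ε₀ (𝒟.ψ i) n) ξ‖ₑ ^ (2 : ℝ)
      ∂(volume : Measure (EuclideanSpace ℝ (Fin 3))) = 1 := by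
    have h3 := congrArg (fun x : ℝ≥0∞ => x ^ (2 : ℝ)) h
    simpa only [one_div, ENNReal.rpow_inv_rpow two_ne_zero, ENNReal.one_rpow] using h3
  rw [← h2]
  exact lintegral_congr fun ξ => (ENNReal.rpow_two _).symm

/-- The band weight inequality: on the region of scale `n`, `|ξ| ≤ (1+ε₀)ⁿ(1+ε₀/2) ≤ 2(1+ε₀)ⁿ`, and
for `0 ≤ r ≤ 2c`, `(1 + r²)^{10} ≤ 5^{10} (1 + c^{10})²`. [folklore] -/
theorem sobolevWeight_le_of_norm_le {c r : ℝ} (hc : 0 < c) (hr0 : 0 ≤ r) (hr : r ≤ 2 * c) :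
    (1 + r ^ 2) ^ (10 : ℝ) ≤ 5 ^ 10 * (1 + c ^ 10) ^ 2 := by
  rw [show (10 : ℝ) = ((10 : ℕ) : ℝ) by norm_num, Real.rpow_natCast]
  have h1 : r ^ 2 ≤ 4 * c ^ 2 := by nlinarith
  rcases le_or_gt c 1 with hc1 | hc1
  · have h2 : 1 + r ^ 2 ≤ 5 := by nlinarith
    have h3 : (1 : ℝ) ≤ (1 + c ^ 10) ^ 2 := by nlinarith [pow_nonneg hc.le 10]
    calc (1 + r ^ 2) ^ 10 ≤ (5 : ℝ) ^ 10 := pow_le_pow_left₀ (by positivity) h2 10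
      _ = 5 ^ 10 * 1 := (mul_one _).symm
      _ ≤ 5 ^ 10 * (1 + c ^ 10) ^ 2 := by gcongr
  · have h2 : 1 + r ^ 2 ≤ 5 * c ^ 2 := by nlinarith
    calc (1 + r ^ 2) ^ 10 ≤ (5 * c ^ 2) ^ 10 := pow_le_pow_left₀ (by positivity) h2 10
      _ = 5 ^ 10 * (c ^ 10) ^ 2 := by ring
      _ ≤ 5 ^ 10 * (1 + c ^ 10) ^ 2 := by gcongr; linarith [pow_nonneg hc.le 10]

/-- **Pointwise weighted bound of a band sum**: a.e.,
`(1+|ξ|²)^{10} |∑_p c_p(ξ) ψ̂_p(ξ)|² ≤ ∑_p 5^{10}(1+(1+ε₀)^{10n})² c_p(ξ)² |ψ̂_p(ξ)|²`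
(one term survives; on the region of `p`, `(1+|ξ|²)^{10} ≤ 5^{10}(1+(1+ε₀)^{10n})²`). [cite: Tao2016AveragedNS, §4 Lemma 4.1] -/
theorem ae_weight_enorm_bandSum_le (hε₀ : 0 < ε₀) (hε₂ : ε₀ ≤ 2) (𝒟 : CascadeWaveletData ε₀ m)
    (c : Fin m × ℤ → EuclideanSpace ℝ (Fin 3) → ℝ) :
    ∀ᵐ ξ ∂(volume : Measure (EuclideanSpace ℝ (Fin 3))),
      ENNReal.ofReal ((1 + ‖ξ‖ ^ 2) ^ (10 : ℝ)) *
          ‖∑' p : Fin m × ℤ, ((c p ξ : ℝ) : ℂ) • fourierFn (cascadeWavelet ε₀ (𝒟.ψ p.1) p.2) ξ‖ₑ ^ 2 ≤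
        ∑' p : Fin m × ℤ, ENNReal.ofReal (5 ^ 10 * (1 + ((1 + ε₀) ^ p.2) ^ 10) ^ 2 * c p ξ ^ 2) *
          ‖fourierFn (cascadeWavelet ε₀ (𝒟.ψ p.1) p.2) ξ‖ₑ ^ 2 := by
  have hε' : 0 < 1 + ε₀ := by linarith
  filter_upwards [ae_wavelet_cases hε₀ 𝒟] with ξ hξ
  rcases hξ with hall | ⟨p₀, hp₀, hoth⟩
  · simp [hall]
  · rw [tsum_eq_single p₀ (fun p hp => by rw [hoth p hp, smul_zero])]
    refine le_trans ?_ (ENNReal.le_tsum p₀)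
    have hn := 𝒟.norm_of_mem_freqRegion hε' p₀.1 p₀.2 hp₀
    have hcpos : 0 < (1 + ε₀) ^ p₀.2 := zpow_pos hε' _
    have hw : (1 + ‖ξ‖ ^ 2) ^ (10 : ℝ) ≤ 5 ^ 10 * (1 + ((1 + ε₀) ^ p₀.2) ^ 10) ^ 2 :=
      sobolevWeight_le_of_norm_le hcpos (norm_nonneg _) (by nlinarith [hn.2])
    have key : ENNReal.ofReal ((1 + ‖ξ‖ ^ 2) ^ (10 : ℝ)) * ‖((c p₀ ξ : ℝ) : ℂ)‖ₑ ^ 2 ≤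
        ENNReal.ofReal (5 ^ 10 * (1 + ((1 + ε₀) ^ p₀.2) ^ 10) ^ 2 * c p₀ ξ ^ 2) := by
      rw [← ofReal_norm, Complex.norm_real, Real.norm_eq_abs, ← ENNReal.ofReal_pow (abs_nonneg _),
        ← ENNReal.ofReal_mul (by positivity), sq_abs]
      exact ENNReal.ofReal_le_ofReal (mul_le_mul_of_nonneg_right hw (sq_nonneg _))
    calc ENNReal.ofReal ((1 + ‖ξ‖ ^ 2) ^ (10 : ℝ)) *
          ‖((c p₀ ξ : ℝ) : ℂ) • fourierFn (cascadeWavelet ε₀ (𝒟.ψ p₀.1) p₀.2) ξ‖ₑ ^ 2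
        = ENNReal.ofReal ((1 + ‖ξ‖ ^ 2) ^ (10 : ℝ)) * ‖((c p₀ ξ : ℝ) : ℂ)‖ₑ ^ 2 *
            ‖fourierFn (cascadeWavelet ε₀ (𝒟.ψ p₀.1) p₀.2) ξ‖ₑ ^ 2 := by
          rw [enorm_smul, mul_pow, mul_assoc]
      _ ≤ _ := mul_le_mul' key le_rfl

/-- **Integrated weighted bound of a band sum**: if `|c_p| ≤ B_p` then
`∫ (1+|ξ|²)^{10} |∑_p c_p ψ̂_p|² ≤ ∑_p 5^{10}(1+(1+ε₀)^{10n})² B_p²` (`∫ |ψ̂_p|² = 1`). [cite: Tao2016AveragedNS, §4 Lemma 4.1] -/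
theorem lintegral_weight_enorm_bandSum_le (hε₀ : 0 < ε₀) (hε₂ : ε₀ ≤ 2) (𝒟 : CascadeWaveletData ε₀ m)
    (c : Fin m × ℤ → EuclideanSpace ℝ (Fin 3) → ℝ) (B : Fin m × ℤ → ℝ) (hB : ∀ p ξ, |c p ξ| ≤ B p) :
    ∫⁻ ξ, ENNReal.ofReal ((1 + ‖ξ‖ ^ 2) ^ (10 : ℝ)) *
        ‖∑' p : Fin m × ℤ, ((c p ξ : ℝ) : ℂ) • fourierFn (cascadeWavelet ε₀ (𝒟.ψ p.1) p.2) ξ‖ₑ ^ 2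
          ∂(volume : Measure (EuclideanSpace ℝ (Fin 3))) ≤
      ∑' p : Fin m × ℤ, ENNReal.ofReal (5 ^ 10 * (1 + ((1 + ε₀) ^ p.2) ^ 10) ^ 2 * B p ^ 2) := by
  have hε' : 0 < 1 + ε₀ := by linarith
  have hmeas : ∀ p : Fin m × ℤ,
      AEMeasurable (fun ξ => ‖fourierFn (cascadeWavelet ε₀ (𝒟.ψ p.1) p.2) ξ‖ₑ ^ 2) volume :=
    fun p => (Lp.aestronglyMeasurable _).aemeasurable.enorm.pow_const 2
  have hB2 : ∀ p ξ, c p ξ ^ 2 ≤ B p ^ 2 := fun p ξ => by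
    have h := pow_le_pow_left₀ (abs_nonneg _) (hB p ξ) 2
    rwa [sq_abs] at h
  calc ∫⁻ ξ, ENNReal.ofReal ((1 + ‖ξ‖ ^ 2) ^ (10 : ℝ)) *
        ‖∑' p : Fin m × ℤ, ((c p ξ : ℝ) : ℂ) • fourierFn (cascadeWavelet ε₀ (𝒟.ψ p.1) p.2) ξ‖ₑ ^ 2
      ≤ ∫⁻ ξ, ∑' p : Fin m × ℤ, ENNReal.ofReal (5 ^ 10 * (1 + ((1 + ε₀) ^ p.2) ^ 10) ^ 2 * B p ^ 2) *
          ‖fourierFn (cascadeWavelet ε₀ (𝒟.ψ p.1) p.2) ξ‖ₑ ^ 2 := by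
        refine lintegral_mono_ae ?_
        filter_upwards [ae_weight_enorm_bandSum_le hε₀ hε₂ 𝒟 c] with ξ hξ
        refine hξ.trans (ENNReal.tsum_le_tsum fun p => mul_le_mul' (ENNReal.ofReal_le_ofReal ?_) le_rfl)
        exact mul_le_mul_of_nonneg_left (hB2 p ξ) (by positivity)
    _ = ∑' p : Fin m × ℤ, ∫⁻ ξ, ENNReal.ofReal (5 ^ 10 * (1 + ((1 + ε₀) ^ p.2) ^ 10) ^ 2 * B p ^ 2) *
          ‖fourierFn (cascadeWavelet ε₀ (𝒟.ψ p.1) p.2) ξ‖ₑ ^ 2 :=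
        lintegral_tsum fun p => (hmeas p).const_mul _
    _ = ∑' p : Fin m × ℤ, ENNReal.ofReal (5 ^ 10 * (1 + ((1 + ε₀) ^ p.2) ^ 10) ^ 2 * B p ^ 2) := by
        refine tsum_congr fun p => ?_
        rw [lintegral_const_mul'' _ (hmeas p), lintegral_enorm_sq_fourierFn_cascadeWavelet hε' 𝒟 p.1 p.2,
          mul_one]

/-- **Registered sub-goal `stub_bandField_bandSumBound`** (closed form of
`lintegral_weight_enorm_bandSum_le`, the helper this file serves for `stub_bandField_exists`):
`∫ (1+|ξ|²)^{10} |∑_p c_p ψ̂_p|² ≤ ∑_p 5^{10}(1+(1+ε₀)^{10n})² B_p²` for `|c_p| ≤ B_p`. [cite: Tao2016AveragedNS, §4 Lemma 4.1] -/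
theorem stub_bandField_bandSumBound :
    ∀ (ε₀ : ℝ), 0 < ε₀ → ε₀ ≤ 2 → ∀ (m : ℕ) (𝒟 : CascadeWaveletData ε₀ m)
    (c : Fin m × ℤ → EuclideanSpace ℝ (Fin 3) → ℝ) (B : Fin m × ℤ → ℝ),
    (∀ (p : Fin m × ℤ) (ξ : EuclideanSpace ℝ (Fin 3)), |c p ξ| ≤ B p) →
    ∫⁻ ξ, ENNReal.ofReal ((1 + ‖ξ‖ ^ 2) ^ (10 : ℝ)) *
        ‖∑' p : Fin m × ℤ, ((c p ξ : ℝ) : ℂ) • fourierFn (cascadeWavelet ε₀ (𝒟.ψ p.1) p.2) ξ‖ₑ ^ 2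
          ∂(volume : Measure (EuclideanSpace ℝ (Fin 3))) ≤
      ∑' p : Fin m × ℤ, ENNReal.ofReal (5 ^ 10 * (1 + ((1 + ε₀) ^ p.2) ^ 10) ^ 2 * B p ^ 2) :=
  fun _ hε₀ hε₂ _ 𝒟 c B hB => lintegral_weight_enorm_bandSum_le hε₀ hε₂ 𝒟 c B hB

/-- **A band sum with measurable coefficients is a.e.-strongly measurable** (it is a.e. the limit of
its finite partial sums: at a.e. `ξ` at most one term is nonzero). [folklore] -/
theorem aestronglyMeasurable_bandSum (hε₀ : 0 < ε₀) (𝒟 : CascadeWaveletData ε₀ m)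
    {c : Fin m × ℤ → EuclideanSpace ℝ (Fin 3) → ℝ} (hc : ∀ p, Measurable (c p)) :
    AEStronglyMeasurable (fun ξ => ∑' p : Fin m × ℤ,
      ((c p ξ : ℝ) : ℂ) • fourierFn (cascadeWavelet ε₀ (𝒟.ψ p.1) p.2) ξ)
      (volume : Measure (EuclideanSpace ℝ (Fin 3))) := by
  have hterm : ∀ p : Fin m × ℤ, AEStronglyMeasurable
      (fun ξ => ((c p ξ : ℝ) : ℂ) • fourierFn (cascadeWavelet ε₀ (𝒟.ψ p.1) p.2) ξ)
      (volume : Measure (EuclideanSpace ℝ (Fin 3))) := fun p =>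
    (Complex.measurable_ofReal.comp (hc p)).aestronglyMeasurable.smul (Lp.aestronglyMeasurable _)
  refine aestronglyMeasurable_of_tendsto_ae (atTop : Filter (Finset (Fin m × ℤ)))
    (f := fun s ξ => ∑ p ∈ s, ((c p ξ : ℝ) : ℂ) • fourierFn (cascadeWavelet ε₀ (𝒟.ψ p.1) p.2) ξ)
    (fun s => Finset.aestronglyMeasurable_fun_sum s fun p _ => hterm p) ?_
  filter_upwards [ae_wavelet_cases hε₀ 𝒟] with ξ hξ
  have hfin : ∃ s : Finset (Fin m × ℤ), ∀ p ∉ s,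
      ((c p ξ : ℝ) : ℂ) • fourierFn (cascadeWavelet ε₀ (𝒟.ψ p.1) p.2) ξ = 0 := by
    rcases hξ with hall | ⟨p₀, -, hoth⟩
    · exact ⟨∅, fun p _ => by rw [hall p, smul_zero]⟩
    · exact ⟨{p₀}, fun p hp => by rw [hoth p (by simpa using hp), smul_zero]⟩
  obtain ⟨s, hs⟩ := hfin
  exact (summable_of_ne_finset_zero (L := .unconditional _) hs).hasSum

/-- **Conjugation symmetry of a band sum with even real coefficients**: a.e.
`\overline{∑_p c_p(-ξ) ψ̂_p(-ξ)} = ∑_p c_p(ξ) ψ̂_p(ξ)` (the wavelets are real: `ψ̂_p(-ξ) = \overline{ψ̂_p(ξ)}`). [folklore] -/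
theorem ae_conj3_bandSum_neg (hε₀ : 0 < ε₀) (𝒟 : CascadeWaveletData ε₀ m)
    (c : Fin m × ℤ → EuclideanSpace ℝ (Fin 3) → ℝ) (hc : ∀ p ξ, c p (-ξ) = c p ξ) :
    ∀ᵐ ξ ∂(volume : Measure (EuclideanSpace ℝ (Fin 3))),
      conj3 (∑' p : Fin m × ℤ, ((c p (-ξ) : ℝ) : ℂ) • fourierFn (cascadeWavelet ε₀ (𝒟.ψ p.1) p.2) (-ξ)) =
        ∑' p : Fin m × ℤ, ((c p ξ : ℝ) : ℂ) • fourierFn (cascadeWavelet ε₀ (𝒟.ψ p.1) p.2) ξ := by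
  have hconj : ∀ᵐ ξ ∂(volume : Measure (EuclideanSpace ℝ (Fin 3))), ∀ p : Fin m × ℤ,
      fourierFn (cascadeWavelet ε₀ (𝒟.ψ p.1) p.2) (-ξ) =
        conj3 (fourierFn (cascadeWavelet ε₀ (𝒟.ψ p.1) p.2) ξ) :=
    ae_all_iff.2 fun p => fourierFn_neg_eq_conj3 (isReal_cascadeWavelet ε₀ (𝒟.ψ p.1) p.2)
  filter_upwards [ae_wavelet_cases hε₀ 𝒟, hconj] with ξ hξ h2
  simp_rw [h2, hc]
  rcases hξ with hall | ⟨p₀, -, hoth⟩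
  · simp [hall]
  · rw [tsum_eq_single p₀ (fun p hp => by rw [hoth p hp, map_zero, smul_zero]),
      tsum_eq_single p₀ (fun p hp => by rw [hoth p hp, smul_zero]),
      conj3_smul, conj3_conj3, Complex.conj_ofReal]

/-- **A band sum is divergence free on the Fourier side**: a.e. `ξ · ∑_p c_p(ξ) ψ̂_p(ξ) = 0`
(`ξ · ψ̂_p(ξ) = 0`). [folklore] -/
theorem ae_cdot_bandSum_eq_zero (hε₀ : 0 < ε₀) (𝒟 : CascadeWaveletData ε₀ m)
    (c : Fin m × ℤ → EuclideanSpace ℝ (Fin 3) → ℝ) :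
    ∀ᵐ ξ ∂(volume : Measure (EuclideanSpace ℝ (Fin 3))),
      cdot (FunctionSpaces.EuclideanSpace.complexify ξ)
        (∑' p : Fin m × ℤ, ((c p ξ : ℝ) : ℂ) • fourierFn (cascadeWavelet ε₀ (𝒟.ψ p.1) p.2) ξ) = 0 := by
  have hε' : 0 < 1 + ε₀ := by linarith
  have hdiv : ∀ᵐ ξ ∂(volume : Measure (EuclideanSpace ℝ (Fin 3))), ∀ p : Fin m × ℤ,
      cdot (FunctionSpaces.EuclideanSpace.complexify ξ) (fourierFn (cascadeWavelet ε₀ (𝒟.ψ p.1) p.2) ξ) = 0 :=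
    ae_all_iff.2 fun p => 𝒟.isFourierDivFree_cascadeWavelet hε' p.1 p.2
  filter_upwards [ae_wavelet_cases hε₀ 𝒟, hdiv] with ξ hξ h2
  rcases hξ with hall | ⟨p₀, -, hoth⟩
  · simp [hall, cdot]
  · rw [tsum_eq_single p₀ (fun p hp => by rw [hoth p hp, smul_zero]), cdot_smul_right, h2 p₀, mul_zero]

/-- The difference of two band sums is a.e. the band sum of the differences. [folklore] -/
theorem ae_bandSum_sub (hε₀ : 0 < ε₀) (𝒟 : CascadeWaveletData ε₀ m)
    (a b : Fin m × ℤ → EuclideanSpace ℝ (Fin 3) → ℝ) :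
    ∀ᵐ ξ ∂(volume : Measure (EuclideanSpace ℝ (Fin 3))),
      (∑' p : Fin m × ℤ, ((a p ξ : ℝ) : ℂ) • fourierFn (cascadeWavelet ε₀ (𝒟.ψ p.1) p.2) ξ) -
        (∑' p : Fin m × ℤ, ((b p ξ : ℝ) : ℂ) • fourierFn (cascadeWavelet ε₀ (𝒟.ψ p.1) p.2) ξ) =
      ∑' p : Fin m × ℤ, ((a p ξ - b p ξ : ℝ) : ℂ) • fourierFn (cascadeWavelet ε₀ (𝒟.ψ p.1) p.2) ξ := by
  filter_upwards [ae_wavelet_cases hε₀ 𝒟] with ξ hξ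
  rcases hξ with hall | ⟨p₀, -, hoth⟩
  · simp [hall]
  · rw [tsum_eq_single p₀ (fun p hp => by rw [hoth p hp, smul_zero]),
      tsum_eq_single p₀ (fun p hp => by rw [hoth p hp, smul_zero]),
      tsum_eq_single p₀ (fun p hp => by rw [hoth p hp, smul_zero]), Complex.ofReal_sub, sub_smul]

/-! ### From a Fourier-side representative to an `L²` field -/

/-- The Fourier transform of `𝓕⁻¹ g` is `g` (a.e.), for `g ∈ L²`. [folklore] -/
theorem fourierFn_fourierInv_toLp {g : EuclideanSpace ℝ (Fin 3) → EuclideanSpace ℂ (Fin 3)}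
    (hg : MemLp g 2 (volume : Measure (EuclideanSpace ℝ (Fin 3)))) :
    fourierFn (𝓕⁻ (hg.toLp g) : L2C) =ᵐ[volume] g := by
  unfold fourierFn
  rw [fourier_fourierInv_eq]
  exact hg.coeFn_toLp

/-- `𝓕(a - b) = 𝓕a - 𝓕b` almost everywhere. [folklore] -/
theorem fourierFn_sub (a b : L2C) :
    fourierFn (a - b) =ᵐ[volume] fun ξ => fourierFn a ξ - fourierFn b ξ := by
  have h : (𝓕 (a - b) : L2C) = 𝓕 a - 𝓕 b := by
    rw [sub_eq_add_neg, FourierTransform.fourier_add, FourierTransform.fourier_neg, ← sub_eq_add_neg]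
  unfold fourierFn
  rw [h]
  exact Lp.coeFn_sub _ _

/-- A field whose Fourier transform has the conjugation symmetry `\overline{v̂(-ξ)} = v̂(ξ)` is real. [folklore] -/
theorem isReal_of_fourierFn_conj_symm {v : L2C}
    (h : ∀ᵐ ξ ∂(volume : Measure (EuclideanSpace ℝ (Fin 3))), conj3 (fourierFn v (-ξ)) = fourierFn v ξ) :
    IsReal v := by
  rw [isReal_iff_conjL2_eq]
  apply eq_of_fourierFn_ae_eq
  filter_upwards [fourierFn_conjL2 v, h] with ξ h1 h2
  rw [h1, h2]

/-- An a.e.-strongly measurable Fourier-side function with finite weighted integral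
`∫ (1+|ξ|²)^{10} |g|² < ∞` is square integrable. [folklore] -/
theorem memLp_two_of_sobolevWeightIntegral_lt_top {g : EuclideanSpace ℝ (Fin 3) → EuclideanSpace ℂ (Fin 3)}
    (hg : AEStronglyMeasurable g (volume : Measure (EuclideanSpace ℝ (Fin 3))))
    (hfin : sobolevWeightIntegral 10 g < ∞) :
    MemLp g 2 (volume : Measure (EuclideanSpace ℝ (Fin 3))) := by
  refine ⟨hg, ?_⟩
  rw [eLpNorm_lt_top_iff_lintegral_rpow_enorm_lt_top two_ne_zero ENNReal.ofNat_ne_top]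
  simp only [ENNReal.toReal_ofNat, ENNReal.rpow_two]
  refine lt_of_le_of_lt (lintegral_mono fun ξ => ?_) hfin
  refine le_mul_of_one_le_left (zero_le (α := ℝ≥0∞)) ?_
  rw [← ENNReal.ofReal_one]
  exact ENNReal.ofReal_le_ofReal (Real.one_le_rpow (by nlinarith [norm_nonneg ξ]) (by norm_num))

end Summit.NavierStokesRegularity.NavierStokesRegularity.Theorems.PerpetualPumpPumpTransfer

end
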